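import Summits.CriticalPhenomena.PercolationContinuityZ3.Theorems.PercNearOneGluingNearOneGluingS1OfCexch
import Summits.CriticalPhenomena.PercolationContinuityZ3.Theorems.PercNearOneGluingNearOneGluingU1M

/-!
# Crux `PercNearOneGluing.NearOneGluing` (stmt-CriticalPhenomena-4574), line `SketchR2I5` —
# the conditional exchange inequality cEXCH from the four-world inequality (†)

Lead prover-line-stmt-CriticalPhenomena-4574-c7 (cycle 7, wave 4, stub-worker W7 on `stub_cexchS1`).
Lands `--supports stmt-CriticalPhenomena-4574`; no definitions, no named facts.

## Content

Finite weighted graph on `Fin n`, `μ = prodBernoulli w`, `{u ↔ v} = openConn u v`; `x, y, z` pairwise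
distinct, `o, b` arbitrary.  Notation: `X := {x ↔ y}`, `g := {y ↔ b}`, `O := {o ↔ x} ∪ {o ↔ y}`,
`D := {y ↮ z}`, `N₂ := {x ↮ z} ∩ {y ↮ z}`, `N := {x ↮ y} ∩ {x ↮ z} ∩ {y ↮ z}`, `D″ := {y ↮ x} ∩ {y ↮ z}`,
`W := {x ↔ z} ∩ {y ↮ z}`, and `σ₁(Q) := μ(D)·μ(Q ∩ g ∩ D) − μ(Q ∩ D)·μ(g ∩ D)` (`= μ(D)²·Cov(1_Q, 1_g | D)`).

The registered sharp residual of the line (`stub_cexchS1`, **cEXCH**) reads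
`(μ(O ∩ N)μ(D″) − μ({o↔y} ∩ D″)μ(N))·σ₁(X) ≤ μ(N)μ(D″)·σ₁({o↔y})`, i.e.
`Cov_D(1{o↔y}, g) ≥ θ̂·Cov_D(1_X, g)` with `θ̂ = P(O | N) − P(o↔y | D″)`.
The wave-1 analysis (worker report ExchS1.md, crux NOTES §H) found the **four-world inequality (†)**

  `μ(N)μ(D″)·μ(O∩N₂)μ(g∩N₂) + μ(N)μ(N₂)·μ({o↔y}∩D″)μ(g∩D″) ≤ μ(N)μ(N₂)μ(D″)·μ({o↔y}∩g∩D) + μ(N₂)μ(D″)·μ(O∩N)μ(g∩N)`,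

the denominator-free form of `P(N₂)·Cov_{N₂}(1_O, g) + P(D″)·Cov_{D″}(1{o↔y}, g) ≥ P(N)·Cov_N(1_O, g)`
(equivalently: `μ(N₂)·[E3M-slack] ≥ μ(N)Cov_N(1{o↔y}, g) − μ(D″)Cov_{D″}(1{o↔y}, g)`, E3M being the exchange
inequality conditioned on `N₂`), 0 violations in > 10⁵ exact instances (n ≤ 8, all increasing `g`).
This file proves the REDUCTION

  `(†) ⟹ cEXCH`   (`cexch_of_dagger`; registered-signature form `stub_cexchS1_of_dagger`),

from tree facts only, via the exact polynomial identity
`μ(N₂)μ(D″)·[cEXCH-slack] = μ(D)μ(D″)·[(†)-slack] + μ(D″)·P₃·(μ(W)·σ₁(X) + μ(D)·h₁)` in which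
* `P₃ := μ(N)·μ({o↔y} ∩ X ∩ D) − μ(X ∩ D)·μ(O ∩ N) ≥ 0` is Harris' inequality for `O` and `X` given `N₂`
  (BHK Thm. 1.3 for the cluster of the set `{x,y}` given `{x,y} ↮ z`, tree theorem `u1M_harrisM`);
* `h₁ := μ(g ∩ N)·μ(W) − μ(g ∩ W)·μ(N) ≥ 0` is the conditional-disconnection tilt `P(g | D″) ≤ P(g | N)`
  (BHK Thm. 1.4, tree theorem `condDisconnTilt`);
* `σ₁(X) ≥ 0` (BHK Thm. 1.3 given `y ↮ z`, tree theorem `s1red_sigma_nonneg`);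
and the disjoint decompositions `N₂ = (X ∩ D) ⊔ N`, `D″ = N ⊔ W`, `D = (X ∩ D) ⊔ D″`, `O ∩ X ∩ D = {o↔y} ∩ X ∩ D`.
[cite: VandenbergHaggstromKahn2005, Thm. 1.3 (p. 6), Thm. 1.4 (p. 7)] [cite: KozmaNitzan2024, Question 7 (p. 36)]
-/

namespace Summit.CriticalPhenomena.PercolationContinuityZ3.Theorems

open MeasureTheory Set Literature.Probability.LatticeModels Literature.Probability.Percolation
open scoped Classical
open Q7ThreeCut

noncomputable section

variable {n : ℕ}

/-! ### Pointwise facts about the conditioning events -/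

/-- `x ↔ y` and `y ↮ z` force `x ↮ z`. [folklore] -/
theorem cexd_not_xz {ω : BondConfig (Fin n)} {x y z : Fin n}
    (hxy : ω ∈ (openConn x y : Set (BondConfig (Fin n)))) (hyz : ω ∉ (openConn y z : Set (BondConfig (Fin n)))) :
    ω ∉ (openConn x z : Set (BondConfig (Fin n))) :=
  fun hxz => hyz (conn_trans (conn_symm hxy) hxz)

/-- `x ↔ z` and `y ↮ z` force `y ↮ x`. [folklore] -/
theorem cexd_not_yx {ω : BondConfig (Fin n)} {x y z : Fin n}
    (hxz : ω ∈ (openConn x z : Set (BondConfig (Fin n)))) (hyz : ω ∉ (openConn y z : Set (BondConfig (Fin n)))) :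
    ω ∉ (openConn y x : Set (BondConfig (Fin n))) :=
  fun hyx => hyz (conn_trans hyx hxz)

/-- On `{x ↔ y}` the event `O = {o↔x} ∪ {o↔y}` is `{o ↔ y}`. [folklore] -/
theorem cexd_O_of_X {ω : BondConfig (Fin n)} {o x y : Fin n}
    (hO : ω ∈ (openConn o x ∪ openConn o y : Set (BondConfig (Fin n))))
    (hxy : ω ∈ (openConn x y : Set (BondConfig (Fin n)))) :
    ω ∈ (openConn o y : Set (BondConfig (Fin n))) := by
  rcases hO with h | h
  · exact conn_trans h hxy
  · exact h

/-! ### The reduction -/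

/-- **cEXCH from the four-world inequality (†).**  With the notation of the file header: if
`μ(N)μ(D″)μ(O∩N₂)μ(g∩N₂) + μ(N)μ(N₂)μ({o↔y}∩D″)μ(g∩D″) ≤ μ(N)μ(N₂)μ(D″)μ({o↔y}∩g∩D) + μ(N₂)μ(D″)μ(O∩N)μ(g∩N)`
(the inequality (†), `P(N₂)Cov_{N₂}(1_O,g) + P(D″)Cov_{D″}(1{o↔y},g) ≥ P(N)Cov_N(1_O,g)` with denominators
cleared), then `(μ(O∩N)μ(D″) − μ({o↔y}∩D″)μ(N))·σ₁(X) ≤ μ(N)μ(D″)·σ₁({o↔y})` (cEXCH, the registered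
`stub_cexchS1`).  Proof: the polynomial identity
`μ(N₂)μ(D″)·[cEXCH-slack] = μ(D)μ(D″)·[(†)-slack] + μ(D″)·P₃·(μ(W)σ₁(X) + μ(D)h₁)` with `P₃ ≥ 0` (Harris given
`N₂`, `u1M_harrisM`), `h₁ ≥ 0` (`condDisconnTilt`), `σ₁(X) ≥ 0` (`s1red_sigma_nonneg`); if `μ(N₂)μ(D″) = 0` then
`μ(N) = 0` and both sides of cEXCH vanish.
[cite: VandenbergHaggstromKahn2005, Thm. 1.3 (p. 6), Thm. 1.4 (p. 7)] -/
theorem cexch_of_dagger (w : Sym2 (Fin n) → unitInterval) (o b x y z : Fin n) (hxz : x ≠ z) (hyz : y ≠ z)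
    (hdag : (prodBernoulli w).real ((openConn x y)ᶜ ∩ (openConn x z)ᶜ ∩ (openConn y z)ᶜ) *
          (prodBernoulli w).real ((openConn y x)ᶜ ∩ (openConn y z)ᶜ) *
          (prodBernoulli w).real ((openConn o x ∪ openConn o y) ∩ ((openConn x z)ᶜ ∩ (openConn y z)ᶜ)) *
          (prodBernoulli w).real (openConn y b ∩ ((openConn x z)ᶜ ∩ (openConn y z)ᶜ)) +
        (prodBernoulli w).real ((openConn x y)ᶜ ∩ (openConn x z)ᶜ ∩ (openConn y z)ᶜ) *
          (prodBernoulli w).real ((openConn x z)ᶜ ∩ (openConn y z)ᶜ) *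
          (prodBernoulli w).real (openConn o y ∩ ((openConn y x)ᶜ ∩ (openConn y z)ᶜ)) *
          (prodBernoulli w).real (openConn y b ∩ ((openConn y x)ᶜ ∩ (openConn y z)ᶜ)) ≤
      (prodBernoulli w).real ((openConn x y)ᶜ ∩ (openConn x z)ᶜ ∩ (openConn y z)ᶜ) *
          (prodBernoulli w).real ((openConn x z)ᶜ ∩ (openConn y z)ᶜ) *
          (prodBernoulli w).real ((openConn y x)ᶜ ∩ (openConn y z)ᶜ) *
          (prodBernoulli w).real (openConn o y ∩ openConn y b ∩ (openConn y z)ᶜ) +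
        (prodBernoulli w).real ((openConn x z)ᶜ ∩ (openConn y z)ᶜ) *
          (prodBernoulli w).real ((openConn y x)ᶜ ∩ (openConn y z)ᶜ) *
          (prodBernoulli w).real ((openConn o x ∪ openConn o y) ∩ ((openConn x y)ᶜ ∩ (openConn x z)ᶜ ∩ (openConn y z)ᶜ)) *
          (prodBernoulli w).real (openConn y b ∩ ((openConn x y)ᶜ ∩ (openConn x z)ᶜ ∩ (openConn y z)ᶜ))) :
    ((prodBernoulli w).real ((openConn o x ∪ openConn o y) ∩ ((openConn x y)ᶜ ∩ (openConn x z)ᶜ ∩ (openConn y z)ᶜ)) *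
            (prodBernoulli w).real ((openConn y x)ᶜ ∩ (openConn y z)ᶜ) -
          (prodBernoulli w).real (openConn o y ∩ ((openConn y x)ᶜ ∩ (openConn y z)ᶜ)) *
            (prodBernoulli w).real ((openConn x y)ᶜ ∩ (openConn x z)ᶜ ∩ (openConn y z)ᶜ)) *
        ((prodBernoulli w).real (openConn y z)ᶜ *
            (prodBernoulli w).real (openConn x y ∩ openConn y b ∩ (openConn y z)ᶜ) -
          (prodBernoulli w).real (openConn x y ∩ (openConn y z)ᶜ) *
            (prodBernoulli w).real (openConn y b ∩ (openConn y z)ᶜ)) ≤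
      ((prodBernoulli w).real ((openConn x y)ᶜ ∩ (openConn x z)ᶜ ∩ (openConn y z)ᶜ) *
          (prodBernoulli w).real ((openConn y x)ᶜ ∩ (openConn y z)ᶜ)) *
        ((prodBernoulli w).real (openConn y z)ᶜ *
            (prodBernoulli w).real (openConn o y ∩ openConn y b ∩ (openConn y z)ᶜ) -
          (prodBernoulli w).real (openConn o y ∩ (openConn y z)ᶜ) *
            (prodBernoulli w).real (openConn y b ∩ (openConn y z)ᶜ)) := by
  set μ := prodBernoulli w with hμ
  have hm : ∀ s : Set (BondConfig (Fin n)), MeasurableSet s := fun _ => MeasurableSet.of_discrete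
  -- the events
  set X : Set (BondConfig (Fin n)) := openConn x y with hX
  set G : Set (BondConfig (Fin n)) := openConn y b with hG
  set OY : Set (BondConfig (Fin n)) := openConn o y with hOY
  set O : Set (BondConfig (Fin n)) := openConn o x ∪ openConn o y with hO
  set D : Set (BondConfig (Fin n)) := (openConn y z)ᶜ with hD
  set N₂ : Set (BondConfig (Fin n)) := (openConn x z)ᶜ ∩ (openConn y z)ᶜ with hN₂
  set N : Set (BondConfig (Fin n)) := (openConn x y)ᶜ ∩ (openConn x z)ᶜ ∩ (openConn y z)ᶜ with hN
  set Dpp : Set (BondConfig (Fin n)) := (openConn y x)ᶜ ∩ (openConn y z)ᶜ with hDpp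
  set Wz : Set (BondConfig (Fin n)) := openConn x z ∩ (openConn y z)ᶜ with hWz
  -- set identities
  have eXY : (openConn y x : Set (BondConfig (Fin n))) = X := knThm2_openConn_comm y x
  have sN₂X : N₂ ∩ X = X ∩ D := by
    ext ω; simp only [hN₂, hD, mem_inter_iff, mem_compl_iff]
    exact ⟨fun h => ⟨h.2, h.1.2⟩, fun h => ⟨⟨cexd_not_xz h.1 h.2, h.2⟩, h.1⟩⟩
  have sN₂dX : N₂ \ X = N := by
    ext ω; simp only [hN₂, hN, mem_sdiff, mem_inter_iff, mem_compl_iff]; tauto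
  have sDppxz : Dpp ∩ openConn x z = Wz := by
    ext ω; simp only [hDpp, hWz, mem_inter_iff, mem_compl_iff]
    exact ⟨fun h => ⟨h.2, h.1.2⟩, fun h => ⟨⟨cexd_not_yx h.1 h.2, h.2⟩, h.1⟩⟩
  have sDppdxz : Dpp \ openConn x z = N := by
    rw [hDpp, eXY]; ext ω; simp only [hN, hX, mem_sdiff, mem_inter_iff, mem_compl_iff]; tauto
  have sDX : D ∩ X = X ∩ D := inter_comm _ _
  have sDdX : D \ X = Dpp := by
    rw [hDpp, eXY]; ext ω; simp only [hD, mem_sdiff, mem_inter_iff, mem_compl_iff]; tauto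
  have sON₂X : O ∩ N₂ ∩ X = OY ∩ X ∩ D := by
    ext ω; simp only [mem_inter_iff]
    constructor
    · rintro ⟨⟨hO', hN'⟩, hX'⟩
      exact ⟨⟨cexd_O_of_X hO' hX', hX'⟩, hN'.2⟩
    · rintro ⟨⟨hoy, hX'⟩, hD'⟩
      exact ⟨⟨Or.inr hoy, ⟨cexd_not_xz hX' hD', hD'⟩⟩, hX'⟩
  have sON₂dX : (O ∩ N₂) \ X = O ∩ N := by
    rw [Set.sdiff_eq, inter_assoc, ← Set.sdiff_eq, sN₂dX]
  have sGN₂X : G ∩ N₂ ∩ X = X ∩ G ∩ D := by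
    rw [inter_assoc, sN₂X, ← inter_assoc, inter_comm G X]
  have sGN₂dX : (G ∩ N₂) \ X = G ∩ N := by
    rw [Set.sdiff_eq, inter_assoc, ← Set.sdiff_eq, sN₂dX]
  have sOYDX : OY ∩ D ∩ X = OY ∩ X ∩ D := by
    rw [inter_assoc, sDX, ← inter_assoc]
  have sOYDdX : (OY ∩ D) \ X = OY ∩ Dpp := by
    rw [Set.sdiff_eq, inter_assoc, ← Set.sdiff_eq, sDdX]
  have sGDX : G ∩ D ∩ X = X ∩ G ∩ D := by
    rw [inter_assoc, sDX, ← inter_assoc, inter_comm G X]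
  have sGDdX : (G ∩ D) \ X = G ∩ Dpp := by
    rw [Set.sdiff_eq, inter_assoc, ← Set.sdiff_eq, sDdX]
  have sGDppxz : G ∩ Dpp ∩ openConn x z = G ∩ Wz := by
    rw [inter_assoc, sDppxz]
  have sGDppdxz : (G ∩ Dpp) \ openConn x z = G ∩ N := by
    rw [Set.sdiff_eq, inter_assoc, ← Set.sdiff_eq, sDppdxz]
  -- atoms
  set χ := μ.real (X ∩ D) with hχ
  set m := μ.real N with hmN
  set ω := μ.real Wz with hω
  set oyXD := μ.real (OY ∩ X ∩ D) with hoyXD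
  set oyDpp := μ.real (OY ∩ Dpp) with hoyDpp
  set gXD := μ.real (X ∩ G ∩ D) with hgXD
  set gM := μ.real (G ∩ N) with hgM
  set gW := μ.real (G ∩ Wz) with hgW
  set oygD := μ.real (OY ∩ G ∩ D) with hoygD
  set OM := μ.real (O ∩ N) with hOM
  -- decompositions of the composite masses
  have rN₂ : μ.real N₂ = χ + m := by
    rw [← measureReal_inter_add_sdiff (μ := μ) (s := N₂) (t := X) (hm _), sN₂X, sN₂dX]
  have rDpp : μ.real Dpp = ω + m := by
    rw [← measureReal_inter_add_sdiff (μ := μ) (s := Dpp) (t := openConn x z) (hm _), sDppxz, sDppdxz]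
  have rD : μ.real D = χ + (ω + m) := by
    rw [← measureReal_inter_add_sdiff (μ := μ) (s := D) (t := X) (hm _), sDX, sDdX, rDpp]
  have rON₂ : μ.real (O ∩ N₂) = oyXD + OM := by
    rw [← measureReal_inter_add_sdiff (μ := μ) (s := O ∩ N₂) (t := X) (hm _), sON₂X, sON₂dX]
  have rGN₂ : μ.real (G ∩ N₂) = gXD + gM := by
    rw [← measureReal_inter_add_sdiff (μ := μ) (s := G ∩ N₂) (t := X) (hm _), sGN₂X, sGN₂dX]
  have rGDpp : μ.real (G ∩ Dpp) = gW + gM := by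
    rw [← measureReal_inter_add_sdiff (μ := μ) (s := G ∩ Dpp) (t := openConn x z) (hm _), sGDppxz, sGDppdxz]
  have rOYD : μ.real (OY ∩ D) = oyXD + oyDpp := by
    rw [← measureReal_inter_add_sdiff (μ := μ) (s := OY ∩ D) (t := X) (hm _), sOYDX, sOYDdX]
  have rGD : μ.real (G ∩ D) = gXD + (gW + gM) := by
    rw [← measureReal_inter_add_sdiff (μ := μ) (s := G ∩ D) (t := X) (hm _), sGDX, sGDdX, rGDpp]
  -- (P₃) Harris for `O` and `X` given `N₂` (`u1M_harrisM`): `OM·χ ≤ m·oyXD`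
  have hP3 := u1M_harrisM w o x y z hxz hyz
  change μ.real (N₂ ∩ O) * μ.real (N₂ ∩ X) ≤ μ.real N₂ * μ.real (N₂ ∩ (O ∩ X)) at hP3
  have e31 : N₂ ∩ O = O ∩ N₂ := inter_comm _ _
  have e33 : N₂ ∩ (O ∩ X) = OY ∩ X ∩ D := by rw [inter_comm, inter_assoc, inter_comm X N₂, ← inter_assoc]; exact sON₂X
  rw [e33, e31, sN₂X, rON₂, rN₂] at hP3
  -- (h₁) the tilt `P(g | D″) ≤ P(g | N)` (`condDisconnTilt`): `gW·m ≤ gM·ω`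
  have hT := condDisconnTilt w ({x, z} : Finset (Fin n)) y b x z (by simp)
  rw [s2red_avoid_pair_eq y x z] at hT
  change μ.real (Dpp ∩ G) * μ.real (Dpp ∩ (openConn x z)ᶜ) ≤ μ.real (Dpp ∩ G ∩ (openConn x z)ᶜ) * μ.real Dpp
    at hT
  have e41 : Dpp ∩ G = G ∩ Dpp := inter_comm _ _
  have e42 : Dpp ∩ (openConn x z)ᶜ = N := by rw [← Set.sdiff_eq]; exact sDppdxz
  have e43 : Dpp ∩ G ∩ (openConn x z)ᶜ = G ∩ N := by rw [e41, ← Set.sdiff_eq]; exact sGDppdxz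
  rw [e43, e41, e42, rGDpp, rDpp] at hT
  -- (σ₁(X) ≥ 0) `s1red_sigma_nonneg`: `χ·μ(g∩D) ≤ μ(D)·gXD`
  have hS := s1red_sigma_nonneg w b x y z hyz
  change χ * μ.real (G ∩ D) ≤ μ.real D * gXD at hS
  rw [rGD, rD] at hS
  -- rewrite hypothesis and goal in atoms
  rw [rDpp, rON₂, rGN₂, rN₂, rGDpp] at hdag
  rw [rDpp, rD, rGD, rOYD]
  -- signs
  have hχ0 : 0 ≤ χ := measureReal_nonneg
  have hm0 : 0 ≤ m := measureReal_nonneg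
  have hω0 : 0 ≤ ω := measureReal_nonneg
  have hOM_le : OM ≤ m := by rw [hOM, hmN]; exact measureReal_mono inter_subset_right
  have hOM0 : 0 ≤ OM := measureReal_nonneg
  have hP3' : 0 ≤ m * oyXD - χ * OM := by linarith
  have hT' : 0 ≤ gM * ω - gW * m := by linarith
  have hS' : 0 ≤ (χ + (ω + m)) * gXD - χ * (gXD + (gW + gM)) := sub_nonneg.2 hS
  have hdag' : 0 ≤ m * (χ + m) * (ω + m) * oygD + (χ + m) * (ω + m) * OM * gM -
      (m * (ω + m) * (oyXD + OM) * (gXD + gM) + m * (χ + m) * oyDpp * (gW + gM)) := sub_nonneg.2 hdag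
  -- the polynomial identity
  have key : (χ + m) * (ω + m) *
      ((m * (ω + m)) * ((χ + (ω + m)) * oygD - (oyXD + oyDpp) * (gXD + (gW + gM))) -
        (OM * (ω + m) - oyDpp * m) * ((χ + (ω + m)) * gXD - χ * (gXD + (gW + gM)))) =
      (χ + (ω + m)) * (ω + m) *
          (m * (χ + m) * (ω + m) * oygD + (χ + m) * (ω + m) * OM * gM -
            (m * (ω + m) * (oyXD + OM) * (gXD + gM) + m * (χ + m) * oyDpp * (gW + gM))) +
        (ω + m) * (m * oyXD - χ * OM) *
          (ω * ((χ + (ω + m)) * gXD - χ * (gXD + (gW + gM))) + (χ + (ω + m)) * (gM * ω - gW * m)) := by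
    ring
  have hprod : 0 ≤ (χ + m) * (ω + m) *
      ((m * (ω + m)) * ((χ + (ω + m)) * oygD - (oyXD + oyDpp) * (gXD + (gW + gM))) -
        (OM * (ω + m) - oyDpp * m) * ((χ + (ω + m)) * gXD - χ * (gXD + (gW + gM)))) := by
    rw [key]
    have h1 : 0 ≤ (χ + (ω + m)) * (ω + m) := by positivity
    have h2 : 0 ≤ ω * ((χ + (ω + m)) * gXD - χ * (gXD + (gW + gM))) + (χ + (ω + m)) * (gM * ω - gW * m) :=
      add_nonneg (mul_nonneg hω0 hS') (mul_nonneg (by positivity) hT')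
    exact add_nonneg (mul_nonneg h1 hdag') (mul_nonneg (mul_nonneg (by positivity) hP3') h2)
  by_cases hdeg : (χ + m) * (ω + m) = 0
  · -- degenerate case: `m = 0`, hence `OM = 0`, and both sides vanish
    have hm_z : m = 0 := by
      rcases mul_eq_zero.1 hdeg with h | h
      · linarith
      · linarith
    have hOM_z : OM = 0 := le_antisymm (by simpa [hm_z] using hOM_le) hOM0
    rw [hm_z, hOM_z]; simp
  · have hpos : 0 < (χ + m) * (ω + m) := lt_of_le_of_ne (by positivity) (Ne.symm hdeg)
    refine le_of_mul_le_mul_left (sub_nonneg.1 ?_) hpos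
    rw [← mul_sub]
    exact hprod

/-! ### Registered-signature forms -/

/-- **cEXCH from (†), registered-signature form**: the four-world inequality (†) (for all graphs and all
`o b x y z` with `x, y, z` distinct) implies the registered `stub_cexchS1` signature. [folklore] -/
theorem stub_cexchS1_of_dagger
    (hdag : ∀ (n : ℕ) (w : Sym2 (Fin n) → unitInterval) (o b x y z : Fin n), x ≠ y → x ≠ z → y ≠ z → (Literature.Probability.LatticeModels.prodBernoulli w).real ((Literature.Probability.Percolation.openConn x y)ᶜ ∩ (Literature.Probability.Percolation.openConn x z)ᶜ ∩ (Literature.Probability.Percolation.openConn y z)ᶜ) * (Literature.Probability.LatticeModels.prodBernoulli w).real ((Literature.Probability.Percolation.openConn y x)ᶜ ∩ (Literature.Probability.Percolation.openConn y z)ᶜ) * (Literature.Probability.LatticeModels.prodBernoulli w).real ((Literature.Probability.Percolation.openConn o x ∪ Literature.Probability.Percolation.openConn o y) ∩ ((Literature.Probability.Percolation.openConn x z)ᶜ ∩ (Literature.Probability.Percolation.openConn y z)ᶜ)) * (Literature.Probability.LatticeModels.prodBernoulli w).real (Literature.Probability.Percolation.openConn y b ∩ ((Literature.Probability.Percolation.openConn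 x z)ᶜ ∩ (Literature.Probability.Percolation.openConn y z)ᶜ)) + (Literature.Probability.LatticeModels.prodBernoulli w).real ((Literature.Probability.Percolation.openConn x y)ᶜ ∩ (Literature.Probability.Percolation.openConn x z)ᶜ ∩ (Literature.Probability.Percolation.openConn y z)ᶜ) * (Literature.Probability.LatticeModels.prodBernoulli w).real ((Literature.Probability.Percolation.openConn x z)ᶜ ∩ (Literature.Probability.Percolation.openConn y z)ᶜ) * (Literature.Probability.LatticeModels.prodBernoulli w).real (Literature.Probability.Percolation.openConn o y ∩ ((Literature.Probability.Percolation.openConn y x)ᶜ ∩ (Literature.Probability.Percolation.openConn y z)ᶜ)) * (Literature.Probability.LatticeModels.prodBernoulli w).real (Literature.Probability.Percolation.openConn y b ∩ ((Literature.Probability.Percolation.openConn y x)ᶜ ∩ (Literature.Probability.Percolation.openConn y z)ᶜ)) ≤ (Literature.Probability.LatticeModels.prodBernoulli w).real ((Literature.Probability.Percolation.openConn x y)ᶜ ∩ (Literature.Probability.Percolation.openConn x z)ᶜ ∩ (Literature.Probability.Percolation.openConn y z)ᶜ) * (Literature.Probability.LatticeModels.prodBernoulli w).real ((Literature.Probability.Percolation.openConn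 x z)ᶜ ∩ (Literature.Probability.Percolation.openConn y z)ᶜ) * (Literature.Probability.LatticeModels.prodBernoulli w).real ((Literature.Probability.Percolation.openConn y x)ᶜ ∩ (Literature.Probability.Percolation.openConn y z)ᶜ) * (Literature.Probability.LatticeModels.prodBernoulli w).real (Literature.Probability.Percolation.openConn o y ∩ Literature.Probability.Percolation.openConn y b ∩ (Literature.Probability.Percolation.openConn y z)ᶜ) + (Literature.Probability.LatticeModels.prodBernoulli w).real ((Literature.Probability.Percolation.openConn x z)ᶜ ∩ (Literature.Probability.Percolation.openConn y z)ᶜ) * (Literature.Probability.LatticeModels.prodBernoulli w).real ((Literature.Probability.Percolation.openConn y x)ᶜ ∩ (Literature.Probability.Percolation.openConn y z)ᶜ) * (Literature.Probability.LatticeModels.prodBernoulli w).real ((Literature.Probability.Percolation.openConn o x ∪ Literature.Probability.Percolation.openConn o y) ∩ ((Literature.Probability.Percolation.openConn x y)ᶜ ∩ (Literature.Probability.Percolation.openConn x z)ᶜ ∩ (Literature.Probability.Percolation.openConn y z)ᶜ)) * (Literature.Probability.LatticeModels.prodBernoulli w).real (Literature.Probability.Percolation.openConn y b ∩ ((Literature.Probability.Percolation.openConn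 x y)ᶜ ∩ (Literature.Probability.Percolation.openConn x z)ᶜ ∩ (Literature.Probability.Percolation.openConn y z)ᶜ))) :
    ∀ (n : ℕ) (w : Sym2 (Fin n) → unitInterval) (o b x y z : Fin n), x ≠ y → x ≠ z → y ≠ z → ((Literature.Probability.LatticeModels.prodBernoulli w).real ((Literature.Probability.Percolation.openConn o x ∪ Literature.Probability.Percolation.openConn o y) ∩ ((Literature.Probability.Percolation.openConn x y)ᶜ ∩ (Literature.Probability.Percolation.openConn x z)ᶜ ∩ (Literature.Probability.Percolation.openConn y z)ᶜ)) * (Literature.Probability.LatticeModels.prodBernoulli w).real ((Literature.Probability.Percolation.openConn y x)ᶜ ∩ (Literature.Probability.Percolation.openConn y z)ᶜ) - (Literature.Probability.LatticeModels.prodBernoulli w).real (Literature.Probability.Percolation.openConn o y ∩ ((Literature.Probability.Percolation.openConn y x)ᶜ ∩ (Literature.Probability.Percolation.openConn y z)ᶜ)) * (Literature.Probability.LatticeModels.prodBernoulli w).real ((Literature.Probability.Percolation.openConn x y)ᶜ ∩ (Literature.Probability.Percolation.openConn x z)ᶜ ∩ (Literature.Probability.Percolation.openConn y z)ᶜ))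 * ((Literature.Probability.LatticeModels.prodBernoulli w).real (Literature.Probability.Percolation.openConn y z)ᶜ * (Literature.Probability.LatticeModels.prodBernoulli w).real (Literature.Probability.Percolation.openConn x y ∩ Literature.Probability.Percolation.openConn y b ∩ (Literature.Probability.Percolation.openConn y z)ᶜ) - (Literature.Probability.LatticeModels.prodBernoulli w).real (Literature.Probability.Percolation.openConn x y ∩ (Literature.Probability.Percolation.openConn y z)ᶜ) * (Literature.Probability.LatticeModels.prodBernoulli w).real (Literature.Probability.Percolation.openConn y b ∩ (Literature.Probability.Percolation.openConn y z)ᶜ)) ≤ ((Literature.Probability.LatticeModels.prodBernoulli w).real ((Literature.Probability.Percolation.openConn x y)ᶜ ∩ (Literature.Probability.Percolation.openConn x z)ᶜ ∩ (Literature.Probability.Percolation.openConn y z)ᶜ) * (Literature.Probability.LatticeModels.prodBernoulli w).real ((Literature.Probability.Percolation.openConn y x)ᶜ ∩ (Literature.Probability.Percolation.openConn y z)ᶜ)) * ((Literature.Probability.LatticeModels.prodBernoulli w).real (Literature.Probability.Percolation.openConn y z)ᶜ * (Literature.Probability.LatticeModels.prodBernoulli w).real (Literature.Probability.Percolation.openConn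 o y ∩ Literature.Probability.Percolation.openConn y b ∩ (Literature.Probability.Percolation.openConn y z)ᶜ) - (Literature.Probability.LatticeModels.prodBernoulli w).real (Literature.Probability.Percolation.openConn o y ∩ (Literature.Probability.Percolation.openConn y z)ᶜ) * (Literature.Probability.LatticeModels.prodBernoulli w).real (Literature.Probability.Percolation.openConn y b ∩ (Literature.Probability.Percolation.openConn y z)ᶜ)) :=
  fun _ w o b x y z _ hxz hyz => cexch_of_dagger w o b x y z hxz hyz (hdag _ w o b x y z ‹_› hxz hyz)

/-- **S1 from (†)** (pointwise): the four-world inequality (†) implies the exchange slack inequality S1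
(the registered `stub_exchS1`), by `cexch_of_dagger` and `exchS1_of_cexch`.
[cite: KozmaNitzan2024, Question 7 (p. 36)] -/
theorem exchS1_of_dagger (w : Sym2 (Fin n) → unitInterval) (o b x y z : Fin n) (hxz : x ≠ z) (hyz : y ≠ z)
    (hdag : (Literature.Probability.LatticeModels.prodBernoulli w).real ((Literature.Probability.Percolation.openConn x y)ᶜ ∩ (Literature.Probability.Percolation.openConn x z)ᶜ ∩ (Literature.Probability.Percolation.openConn y z)ᶜ) * (Literature.Probability.LatticeModels.prodBernoulli w).real ((Literature.Probability.Percolation.openConn y x)ᶜ ∩ (Literature.Probability.Percolation.openConn y z)ᶜ) * (Literature.Probability.LatticeModels.prodBernoulli w).real ((Literature.Probability.Percolation.openConn o x ∪ Literature.Probability.Percolation.openConn o y) ∩ ((Literature.Probability.Percolation.openConn x z)ᶜ ∩ (Literature.Probability.Percolation.openConn y z)ᶜ)) * (Literature.Probability.LatticeModels.prodBernoulli w).real (Literature.Probability.Percolation.openConn y b ∩ ((Literature.Probability.Percolation.openConn x z)ᶜ ∩ (Literature.Probability.Percolation.openConn y z)ᶜ)) + (Literature.Probability.LatticeModels.prodBernoulli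 w).real ((Literature.Probability.Percolation.openConn x y)ᶜ ∩ (Literature.Probability.Percolation.openConn x z)ᶜ ∩ (Literature.Probability.Percolation.openConn y z)ᶜ) * (Literature.Probability.LatticeModels.prodBernoulli w).real ((Literature.Probability.Percolation.openConn x z)ᶜ ∩ (Literature.Probability.Percolation.openConn y z)ᶜ) * (Literature.Probability.LatticeModels.prodBernoulli w).real (Literature.Probability.Percolation.openConn o y ∩ ((Literature.Probability.Percolation.openConn y x)ᶜ ∩ (Literature.Probability.Percolation.openConn y z)ᶜ)) * (Literature.Probability.LatticeModels.prodBernoulli w).real (Literature.Probability.Percolation.openConn y b ∩ ((Literature.Probability.Percolation.openConn y x)ᶜ ∩ (Literature.Probability.Percolation.openConn y z)ᶜ)) ≤ (Literature.Probability.LatticeModels.prodBernoulli w).real ((Literature.Probability.Percolation.openConn x y)ᶜ ∩ (Literature.Probability.Percolation.openConn x z)ᶜ ∩ (Literature.Probability.Percolation.openConn y z)ᶜ) * (Literature.Probability.LatticeModels.prodBernoulli w).real ((Literature.Probability.Percolation.openConn x z)ᶜ ∩ (Literature.Probability.Percolation.openConn y z)ᶜ) * (Literature.Probability.LatticeModels.prodBernoulli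 w).real ((Literature.Probability.Percolation.openConn y x)ᶜ ∩ (Literature.Probability.Percolation.openConn y z)ᶜ) * (Literature.Probability.LatticeModels.prodBernoulli w).real (Literature.Probability.Percolation.openConn o y ∩ Literature.Probability.Percolation.openConn y b ∩ (Literature.Probability.Percolation.openConn y z)ᶜ) + (Literature.Probability.LatticeModels.prodBernoulli w).real ((Literature.Probability.Percolation.openConn x z)ᶜ ∩ (Literature.Probability.Percolation.openConn y z)ᶜ) * (Literature.Probability.LatticeModels.prodBernoulli w).real ((Literature.Probability.Percolation.openConn y x)ᶜ ∩ (Literature.Probability.Percolation.openConn y z)ᶜ) * (Literature.Probability.LatticeModels.prodBernoulli w).real ((Literature.Probability.Percolation.openConn o x ∪ Literature.Probability.Percolation.openConn o y) ∩ ((Literature.Probability.Percolation.openConn x y)ᶜ ∩ (Literature.Probability.Percolation.openConn x z)ᶜ ∩ (Literature.Probability.Percolation.openConn y z)ᶜ)) * (Literature.Probability.LatticeModels.prodBernoulli w).real (Literature.Probability.Percolation.openConn y b ∩ ((Literature.Probability.Percolation.openConn x y)ᶜ ∩ (Literature.Probability.Percolation.openConn x z)ᶜ ∩ (Literature.Probability.Percolation.openConn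 y z)ᶜ))) :
    (Literature.Probability.LatticeModels.prodBernoulli w).real (((Literature.Probability.Percolation.openConn x y)ᶜ ∩ (Literature.Probability.Percolation.openConn x z)ᶜ) ∩ Literature.Probability.Percolation.openConn o x) * ((Literature.Probability.LatticeModels.prodBernoulli w).real (Literature.Probability.Percolation.openConn y z)ᶜ * (Literature.Probability.LatticeModels.prodBernoulli w).real (Literature.Probability.Percolation.openConn x y ∩ Literature.Probability.Percolation.openConn y b ∩ (Literature.Probability.Percolation.openConn y z)ᶜ) - (Literature.Probability.LatticeModels.prodBernoulli w).real (Literature.Probability.Percolation.openConn x y ∩ (Literature.Probability.Percolation.openConn y z)ᶜ) * (Literature.Probability.LatticeModels.prodBernoulli w).real (Literature.Probability.Percolation.openConn y b ∩ (Literature.Probability.Percolation.openConn y z)ᶜ)) ≤ (Literature.Probability.LatticeModels.prodBernoulli w).real ((Literature.Probability.Percolation.openConn x y)ᶜ ∩ (Literature.Probability.Percolation.openConn x z)ᶜ) * ((Literature.Probability.LatticeModels.prodBernoulli w).real (Literature.Probability.Percolation.openConn y z)ᶜ * (Literature.Probability.LatticeModels.prodBernoulli w).real (Literature.Probability.Percolation.openConn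 o y ∩ Literature.Probability.Percolation.openConn y b ∩ (Literature.Probability.Percolation.openConn y z)ᶜ) - (Literature.Probability.LatticeModels.prodBernoulli w).real (Literature.Probability.Percolation.openConn o y ∩ (Literature.Probability.Percolation.openConn y z)ᶜ) * (Literature.Probability.LatticeModels.prodBernoulli w).real (Literature.Probability.Percolation.openConn y b ∩ (Literature.Probability.Percolation.openConn y z)ᶜ)) :=
  exchS1_of_cexch w o b x y z hyz (cexch_of_dagger w o b x y z hxz hyz hdag)

end

end Summit.CriticalPhenomena.PercolationContinuityZ3.Theorems
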